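import Summits.CriticalPhenomena.PercolationContinuityZ3.Theorems.PercNearOneGluingNoHeavyLowerTailQ44SingleSourceOffCore
import Summits.CriticalPhenomena.PercolationContinuityZ3.Theorems.PercNearOneGluingNoHeavyLowerTailNineTypeLabelAtlas

/-!
# The full single-source packing `K1+K2+K4+K5+K4s+ab+ac` reduces to its two cores

Support file for crux `stmt-CriticalPhenomena-4575` (master-family programme, row `Q44`, single-source packing
`g ≥ b1 + h_a`), seat `prim-bnk-1` gen 28; memo `run/shared/lean/prim/prim-l12/FROM-prim-bnk-1-gen28-DECISION-LIST.md` §2(c), §4.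

**Theorem (`pack_singleSource_of_cores`, all `n`).**  Fix marked points `a b c y` of `Fin n`.  Suppose that in every graph fibre
`(M, C)` that has an `a`-lobe (a side of type `(ab|c|y ; a|bcy)` or `(ac|b|y ; a|bcy)`), every nonempty family of sides of the seven
single-source types lying in CORE A (a `K4[ab]`- and a `K4s[ay|bc]`-side present) or CORE B (a `Pc`-, a `K1[ab|cy]`- and a `K5[ab]`-
or `K4[ab]`-side present) has an odd target among the goods.  Then on every finite weighted graph on `Fin n`
`P(ab|cy)[P(ac|by)+P(ay|bc)] + P(ab|c|y)[P(ay|bc)+P(a|b|cy)] + P(ay|bc)P(a|b|cy) + [P(ab|c|y)+P(ac|b|y)]·P(a|bcy) ≤ [P(ab|cy)+P(abcy)]·P(⊥)`.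

The fibre count (`fibreCount_singleSource_of_cores`) is: in a fibre WITHOUT `a`-lobes the seven-type count is the weight-two count
`B1`, bounded by the label certificate `tableOK_q44WeightTwo` (`cellCount` via `fibre_nonneg_of_goodKernel`, after swapping the
orientation of the `K5`- and `K4s`-points, `card_sides_swap`); in a fibre WITH an `a`-lobe every nonempty sub-family has an odd
target by `exists_odd_good_singleSource_offCore` off the cores and by hypothesis on them, so `card_le_card_of_oddTargets` applies.
This is the analogue of `q44_cells_of_kernelPeelable` for the single-source law: the two core statements (memo §3: certified in every
one of > 10⁷ tested instances by a sub-kernel of an `a→b` lobe or a co-good of size ≤ 3) are all that is missing.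
No sorries, no definitions, standard axioms.
-/

namespace Summit.CriticalPhenomena.PercolationContinuityZ3.Theorems

namespace TwoCopyMono

open Finset FourPointAtoms KernelPeeling Literature.Probability.Percolation

variable {n : ℕ}

/-! ## Counting sides by type -/

/-- Swapping the orientation of a point does not change its count in a fibre: `T ↦ M ∖ T`. [this work] -/
theorem card_sides_swap (M : Finset (Sym2 (Fin n))) (ι : Finset (Sym2 (Fin n)) → Fin 15) (h l : Fin 15) :
    #(M.powerset.filter fun T => (ι T, ι (M \ T)) = (h, l)) = #(M.powerset.filter fun T => (ι T, ι (M \ T)) = (l, h)) := by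
  refine Finset.card_bij (fun T _ => M \ T) ?_ ?_ ?_
  · intro T hT
    rw [Finset.mem_filter, Finset.mem_powerset] at hT ⊢
    rw [Finset.sdiff_sdiff_eq_self hT.1, Prod.mk.injEq]
    rw [Prod.mk.injEq] at hT
    exact ⟨Finset.sdiff_subset, hT.2.2, hT.2.1⟩
  · intro T₁ h₁ T₂ h₂ heq
    rw [Finset.mem_filter, Finset.mem_powerset] at h₁ h₂
    rw [← Finset.sdiff_sdiff_eq_self h₁.1, ← Finset.sdiff_sdiff_eq_self h₂.1, heq]
  · intro T hT
    rw [Finset.mem_filter, Finset.mem_powerset] at hT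
    refine ⟨M \ T, ?_, Finset.sdiff_sdiff_eq_self hT.1⟩
    rw [Finset.mem_filter, Finset.mem_powerset, Finset.sdiff_sdiff_eq_self hT.1, Prod.mk.injEq]
    rw [Prod.mk.injEq] at hT
    exact ⟨Finset.sdiff_subset, hT.2.2, hT.2.1⟩

/-- Counting sides over a disjoint union of type sets. [this work] -/
theorem card_sides_union (s : Finset (Finset (Sym2 (Fin n)))) (f : Finset (Sym2 (Fin n)) → Fin 15 × Fin 15)
    (Q₁ Q₂ : Finset (Fin 15 × Fin 15)) (hd : Disjoint Q₁ Q₂) :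
    #(s.filter fun T => f T ∈ Q₁ ∪ Q₂) = #(s.filter fun T => f T ∈ Q₁) + #(s.filter fun T => f T ∈ Q₂) := by
  rw [← Finset.card_union_of_disjoint (Finset.disjoint_filter.2 (fun T _ h1 h2 => Finset.disjoint_left.1 hd h1 h2)),
    ← Finset.filter_or]
  congr 1
  exact Finset.filter_congr (fun T _ => by rw [Finset.mem_union])

/-- Counting sides of a single type. [this work] -/
theorem card_sides_singleton (s : Finset (Finset (Sym2 (Fin n)))) (f : Finset (Sym2 (Fin n)) → Fin 15 × Fin 15)
    (q : Fin 15 × Fin 15) : #(s.filter fun T => f T ∈ ({q} : Finset (Fin 15 × Fin 15))) = #(s.filter fun T => f T = q) := by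
  congr 1
  exact Finset.filter_congr (fun T _ => by rw [Finset.mem_singleton])

/-! ## Fibres without `a`-lobes: the label count -/

/-- **Label count in a graph fibre.**  The weight-two sides `{(11,9),(11,8),(6,8),(1,6),(1,8)}` of a fibre are at most its goods
(`tableOK_q44WeightTwo` through `fibre_nonneg_of_goodKernel`). [this work] -/
theorem fibreCount_B1 (a b c y : Fin n) (M C : Finset (Sym2 (Fin n)))
    (ι : Finset (Sym2 (Fin n)) → Fin 15) (hι : ∀ T : Finset (Sym2 (Fin n)), prof a b c y ↑(C ∪ T) = pp (ι T)) :
    #(M.powerset.filter fun T => (ι T, ι (M \ T)) ∈ ({(11, 9), (11, 8), (6, 8), (1, 6), (1, 8)} : Finset (Fin 15 × Fin 15))) ≤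
      #(M.powerset.filter fun T => isAC (ι T) ∧ ι (M \ T) = 0) := by
  classical
  set P : Finset (Fin 15 × Fin 15) := {(11, 9), (11, 8), (6, 8), (1, 6), (1, 8)} with hP
  have h0 := fibre_nonneg_of_goodKernel (goodKernel_kerP _ _ tableOK_q44WeightTwo) a b c y M C
  have h1 : ∀ T ∈ M.powerset, liftK (kerP P) (prof a b c y ↑(C ∪ T)) (prof a b c y ↑(C ∪ (M \ T))) =
      (if isAC (ι T) ∧ ι (M \ T) = 0 then (1 : ℤ) else 0) - (if (ι T, ι (M \ T)) ∈ P then (1 : ℤ) else 0) := by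
    intro T _
    rw [hι T, hι (M \ T), liftK_pp]
    rfl
  rw [Finset.sum_congr rfl h1, Finset.sum_sub_distrib, Finset.sum_boole, Finset.sum_boole] at h0
  have h2 : ((#(M.powerset.filter fun T => (ι T, ι (M \ T)) ∈ P) : ℕ) : ℤ) ≤
      ((#(M.powerset.filter fun T => isAC (ι T) ∧ ι (M \ T) = 0) : ℕ) : ℤ) := by linarith
  exact_mod_cast h2

/-- In a fibre without `a`-lobes the seven single-source types count exactly the weight-two sides (after swapping the
orientation of the `K5`- and `K4s`-points), hence at most the goods. [this work] -/
theorem fibreCount_singleSource_noLobe (a b c y : Fin n) (M C : Finset (Sym2 (Fin n)))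
    (ι : Finset (Sym2 (Fin n)) → Fin 15) (hι : ∀ T : Finset (Sym2 (Fin n)), prof a b c y ↑(C ∪ T) = pp (ι T))
    (hnl : ∀ T ∈ M.powerset, (ι T, ι (M \ T)) ∉ ({(6, 7), (5, 7)} : Finset (Fin 15 × Fin 15))) :
    #(M.powerset.filter fun T => (ι T, ι (M \ T)) ∈
        ({(6, 7), (5, 7), (11, 9), (11, 8), (6, 8), (6, 1), (8, 1)} : Finset (Fin 15 × Fin 15))) ≤
      #(M.powerset.filter fun T => isAC (ι T) ∧ ι (M \ T) = 0) := by
  classical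
  set f : Finset (Sym2 (Fin n)) → Fin 15 × Fin 15 := fun T => (ι T, ι (M \ T)) with hf
  have hsplit7 : ({(6, 7), (5, 7), (11, 9), (11, 8), (6, 8), (6, 1), (8, 1)} : Finset (Fin 15 × Fin 15)) =
      (({(11, 9), (11, 8), (6, 8)} ∪ {(6, 1)}) ∪ {(8, 1)}) ∪ {(6, 7), (5, 7)} := by decide
  have hsplit5 : ({(11, 9), (11, 8), (6, 8), (1, 6), (1, 8)} : Finset (Fin 15 × Fin 15)) =
      ({(11, 9), (11, 8), (6, 8)} ∪ {(1, 6)}) ∪ {(1, 8)} := by decide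
  have hd1 : Disjoint (({(11, 9), (11, 8), (6, 8)} ∪ {(6, 1)}) ∪ {(8, 1)} : Finset (Fin 15 × Fin 15)) {(6, 7), (5, 7)} := by decide
  have hd2 : Disjoint (({(11, 9), (11, 8), (6, 8)} ∪ {(6, 1)}) : Finset (Fin 15 × Fin 15)) {(8, 1)} := by decide
  have hd3 : Disjoint ({(11, 9), (11, 8), (6, 8)} : Finset (Fin 15 × Fin 15)) {(6, 1)} := by decide
  have hd4 : Disjoint (({(11, 9), (11, 8), (6, 8)} ∪ {(1, 6)}) : Finset (Fin 15 × Fin 15)) {(1, 8)} := by decide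
  have hd5 : Disjoint ({(11, 9), (11, 8), (6, 8)} : Finset (Fin 15 × Fin 15)) {(1, 6)} := by decide
  have hzero : #(M.powerset.filter fun T => f T ∈ ({(6, 7), (5, 7)} : Finset (Fin 15 × Fin 15))) = 0 := by
    rw [Finset.card_eq_zero, Finset.filter_eq_empty_iff]
    intro T hT; exact hnl T hT
  have h7 : #(M.powerset.filter fun T => f T ∈
      ({(6, 7), (5, 7), (11, 9), (11, 8), (6, 8), (6, 1), (8, 1)} : Finset (Fin 15 × Fin 15))) =
      #(M.powerset.filter fun T => f T ∈ ({(11, 9), (11, 8), (6, 8)} : Finset (Fin 15 × Fin 15))) +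
        #(M.powerset.filter fun T => f T = (6, 1)) + #(M.powerset.filter fun T => f T = (8, 1)) := by
    rw [hsplit7, card_sides_union _ f _ _ hd1, card_sides_union _ f _ _ hd2, card_sides_union _ f _ _ hd3,
      card_sides_singleton, card_sides_singleton, hzero, add_zero]
  have h5 : #(M.powerset.filter fun T => f T ∈ ({(11, 9), (11, 8), (6, 8), (1, 6), (1, 8)} : Finset (Fin 15 × Fin 15))) =
      #(M.powerset.filter fun T => f T ∈ ({(11, 9), (11, 8), (6, 8)} : Finset (Fin 15 × Fin 15))) +
        #(M.powerset.filter fun T => f T = (1, 6)) + #(M.powerset.filter fun T => f T = (1, 8)) := by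
    rw [hsplit5, card_sides_union _ f _ _ hd4, card_sides_union _ f _ _ hd5, card_sides_singleton, card_sides_singleton]
  have hs1 : #(M.powerset.filter fun T => f T = (6, 1)) = #(M.powerset.filter fun T => f T = (1, 6)) :=
    card_sides_swap M ι 6 1
  have hs2 : #(M.powerset.filter fun T => f T = (8, 1)) = #(M.powerset.filter fun T => f T = (1, 8)) :=
    card_sides_swap M ι 8 1
  have hle := fibreCount_B1 a b c y M C ι hι
  change #(M.powerset.filter fun T => f T ∈ _) ≤ _
  rw [h7, hs1, hs2, ← h5]
  exact hle

/-! ## The fibre count and the law, conditional on the cores -/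

/-- **Fibre count of the full single-source family, given the cores.**  If the fibre has no `a`-lobe this is
`fibreCount_singleSource_noLobe`; otherwise every nonempty sub-family has an odd target — off the cores by
`exists_odd_good_singleSource_offCore`, on the cores by hypothesis. [this work] -/
theorem fibreCount_singleSource_of_cores (a b c y : Fin n) (M C : Finset (Sym2 (Fin n)))
    (ι : Finset (Sym2 (Fin n)) → Fin 15) (hι : ∀ T : Finset (Sym2 (Fin n)), prof a b c y ↑(C ∪ T) = pp (ι T))
    (hcore : (∃ T ∈ M.powerset, (ι T, ι (M \ T)) ∈ ({(6, 7), (5, 7)} : Finset (Fin 15 × Fin 15))) →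
      ∀ 𝒮 : Finset (Finset (Sym2 (Fin n))), 𝒮.Nonempty → (∀ S ∈ 𝒮, S ⊆ M) →
        (∀ S ∈ 𝒮, (ι S, ι (M \ S)) ∈ ({(6, 7), (5, 7), (11, 9), (11, 8), (6, 8), (6, 1), (8, 1)} : Finset (Fin 15 × Fin 15))) →
        (((∃ S ∈ 𝒮, (ι S, ι (M \ S)) = (6, 8)) ∧ (∃ S ∈ 𝒮, (ι S, ι (M \ S)) = (8, 1))) ∨
          ((∃ S ∈ 𝒮, (ι S, ι (M \ S)) = (5, 7)) ∧ (∃ S ∈ 𝒮, (ι S, ι (M \ S)) = (11, 9)) ∧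
            (∃ S ∈ 𝒮, (ι S, ι (M \ S)) = (6, 1) ∨ (ι S, ι (M \ S)) = (6, 8)))) →
        ∃ T ∈ goods (fun T : Finset (Sym2 (Fin n)) => ι (T ∩ M)), Odd #(𝒮.filter (fun S => S ⊆ T))) :
    #(M.powerset.filter fun T => (ι T, ι (M \ T)) ∈
        ({(6, 7), (5, 7), (11, 9), (11, 8), (6, 8), (6, 1), (8, 1)} : Finset (Fin 15 × Fin 15))) ≤
      #(M.powerset.filter fun T => isAC (ι T) ∧ ι (M \ T) = 0) := by
  classical
  by_cases hlobe : ∃ T ∈ M.powerset, (ι T, ι (M \ T)) ∈ ({(6, 7), (5, 7)} : Finset (Fin 15 × Fin 15))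
  · refine card_le_card_of_oddTargets fun 𝒮 h𝒮 hne => ?_
    have h𝒮M : ∀ S ∈ 𝒮, S ⊆ M := fun S hS => Finset.mem_powerset.1 (Finset.mem_filter.1 (h𝒮 hS)).1
    have htyp : ∀ S ∈ 𝒮, (ι S, ι (M \ S)) ∈
        ({(6, 7), (5, 7), (11, 9), (11, 8), (6, 8), (6, 1), (8, 1)} : Finset (Fin 15 × Fin 15)) :=
      fun S hS => (Finset.mem_filter.1 (h𝒮 hS)).2
    -- a fat odd target exists
    have hfat : ∃ T ∈ goods (fun T : Finset (Sym2 (Fin n)) => ι (T ∩ M)), Odd #(𝒮.filter (fun S => S ⊆ T)) := by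
      by_cases hc : ((∃ S ∈ 𝒮, (ι S, ι (M \ S)) = (6, 8)) ∧ (∃ S ∈ 𝒮, (ι S, ι (M \ S)) = (8, 1))) ∨
          ((∃ S ∈ 𝒮, (ι S, ι (M \ S)) = (5, 7)) ∧ (∃ S ∈ 𝒮, (ι S, ι (M \ S)) = (11, 9)) ∧
            (∃ S ∈ 𝒮, (ι S, ι (M \ S)) = (6, 1) ∨ (ι S, ι (M \ S)) = (6, 8)))
      · exact hcore hlobe 𝒮 hne h𝒮M htyp hc
      · rw [not_or] at hc
        exact exists_odd_good_singleSource_offCore a b c y C M ι hι 𝒮 hne h𝒮M htyp hc.1 hc.2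
    -- thin it down to `M`
    obtain ⟨T, hT, hodd⟩ := hfat
    have hTg := (Finset.mem_filter.1 hT).2
    refine ⟨T ∩ M, Finset.mem_filter.2 ⟨Finset.mem_powerset.2 Finset.inter_subset_right, ?_, ?_⟩, ?_⟩
    · exact hTg.1
    · have h2 : M \ (T ∩ M) = Tᶜ ∩ M := by
        ext e; simp [Finset.mem_sdiff, Finset.mem_inter]; tauto
      rw [h2]; exact hTg.2
    · have hEq : 𝒮.filter (fun S => S ⊆ T ∩ M) = 𝒮.filter (fun S => S ⊆ T) := by
        refine Finset.filter_congr fun S hS => ?_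
        exact ⟨fun h => h.trans Finset.inter_subset_left, fun h => Finset.subset_inter h (h𝒮M S hS)⟩
      rw [hEq]; exact hodd
  · refine fibreCount_singleSource_noLobe a b c y M C ι hι fun T hT hmem => hlobe ⟨T, hT, hmem⟩

/-- **The full single-source packing from its cores, all `n`.**  If, for the marked points `a b c y` of `Fin n`, the two core
statements hold in every graph fibre with an `a`-lobe, then on every finite weighted graph on `Fin n`:
`P(ab|c|y)P(a|bcy) + P(ac|b|y)P(a|bcy) + P(ab|cy)P(ac|by) + P(ab|cy)P(ay|bc) + P(ab|c|y)P(ay|bc) + P(ab|c|y)P(a|b|cy) + P(ay|bc)P(a|b|cy)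
 ≤ [P(ab|cy)+P(abcy)]·P(a|b|c|y)`. [this work] -/
theorem pack_singleSource_of_cores (a b c y : Fin n)
    (hcore : ∀ (M C : Finset (Sym2 (Fin n))) (ι : Finset (Sym2 (Fin n)) → Fin 15),
      (∀ T : Finset (Sym2 (Fin n)), prof a b c y ↑(C ∪ T) = pp (ι T)) →
      (∃ T ∈ M.powerset, (ι T, ι (M \ T)) ∈ ({(6, 7), (5, 7)} : Finset (Fin 15 × Fin 15))) →
      ∀ 𝒮 : Finset (Finset (Sym2 (Fin n))), 𝒮.Nonempty → (∀ S ∈ 𝒮, S ⊆ M) →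
        (∀ S ∈ 𝒮, (ι S, ι (M \ S)) ∈ ({(6, 7), (5, 7), (11, 9), (11, 8), (6, 8), (6, 1), (8, 1)} : Finset (Fin 15 × Fin 15))) →
        (((∃ S ∈ 𝒮, (ι S, ι (M \ S)) = (6, 8)) ∧ (∃ S ∈ 𝒮, (ι S, ι (M \ S)) = (8, 1))) ∨
          ((∃ S ∈ 𝒮, (ι S, ι (M \ S)) = (5, 7)) ∧ (∃ S ∈ 𝒮, (ι S, ι (M \ S)) = (11, 9)) ∧
            (∃ S ∈ 𝒮, (ι S, ι (M \ S)) = (6, 1) ∨ (ι S, ι (M \ S)) = (6, 8)))) →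
        ∃ T ∈ goods (fun T : Finset (Sym2 (Fin n)) => ι (T ∩ M)), Odd #(𝒮.filter (fun S => S ⊆ T)))
    (w : Sym2 (Fin n) → unitInterval) :
    cell w a b c y 6 * cell w a b c y 7 +
      cell w a b c y 5 * cell w a b c y 7 +
      cell w a b c y 11 * cell w a b c y 9 +
      cell w a b c y 11 * cell w a b c y 8 +
      cell w a b c y 6 * cell w a b c y 8 +
      cell w a b c y 6 * cell w a b c y 1 +
      cell w a b c y 8 * cell w a b c y 1 ≤
      (cell w a b c y 11 + cell w a b c y 14) * cell w a b c y 0 := by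
  have h := pack_of_graphFibreCount
    ({(6, 7), (5, 7), (11, 9), (11, 8), (6, 8), (6, 1), (8, 1)} : Finset (Fin 15 × Fin 15)) a b c y
    (fun M C _ ι hι => fibreCount_singleSource_of_cores a b c y M C ι hι (hcore M C ι hι)) w
  rw [Finset.sum_insert (by decide), Finset.sum_insert (by decide), Finset.sum_insert (by decide),
    Finset.sum_insert (by decide), Finset.sum_insert (by decide), Finset.sum_insert (by decide), Finset.sum_singleton] at h
  dsimp only at h
  linarith

end TwoCopyMono

end Summit.CriticalPhenomena.PercolationContinuityZ3.Theorems
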